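import Summits.HodgeConjecture.HodgeConjecture.Theorems.F0P6aPELInputs   -- ★ (K6) home of the P-LINE `Lines/F0_P6a_PELInputs.lean` ED. 4 (tree bytes re-homed, namespace `…Cruxes.HLiu418.F0P6aPELInputs` KEPT; MUST LAND BEFORE THIS FILE): `PELSpreadAt`, the laws, `RecordPELSpreadCofinal`, `DualPairOfAmpleRigidified`, `pel_of_inputs`
import Literature.AlgebraicGeometry.AbelianSchemes.PELTupleStageLocalise                  -- ★ (GS-2-core) p847586 (B-p18): stage currency `Idx`∕`baseDiagram`∕`specOver`∕`◁`, `localise_total`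
import Literature.AlgebraicGeometry.AbelianSchemes.PolarizedTupleStageSpecialInjectivity -- ★ p848591 (LA4-p03 (g0)) INJ0 CORE ZIP `exists_finite_forall_geomReductionMap_eq_of_tupleIso_stage` — pays `stub_INJ0` IN-LINE
import HarnessLib

/-!
# `F0P6aPELSpreadDefs` — ★ RE-HOME «HUB TWIN MINUS SOCKETS» (K5-H3; rung-0 re-homing, LEAD F0P6-plan «M-72»∕«M-139a»∕«M-140»; RE-HOME TABLE v1.7 (LA7-plan (g7))) of the L4 hub `Lines/F0_P6a_PELSpread.lean`

This `Theorems/` module is the TREE BYTES of `Summits/HodgeConjecture/HodgeConjecture/Cruxes/HLiu418/Lines/F0_P6a_PELSpread.lean` (edition of record ED. 1, tree sha16 fbcf7a4ea354fd35, 343 l.)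
MINUS EXACTLY its three `sorry`-carrying ∕ `sorry`-instantiating declarations — the sockets `stub_GSPREAD` (tree :247–:254 with docstring), `stub_ELAWS` (:283–:292) and the
junction `spread_of_line := spread_of_parts stub_GSPREAD stub_INJ0 stub_ELAWS` (:332–:336), each replaced below by a `/-! SOCKET … KEPT IN THE Lines HUB -/` note — with the
NAMESPACE KEPT, `Summit.HodgeConjecture.HodgeConjecture.Cruxes.HLiu418.F0P6aPELSpread`, so that every fully-qualified name of the 7 kept declarations (`stageLocLeg`, `IsStageLocalisationAt`, `RecordESpreadCofinal`, `RecordInj0OfStageCofinal`, `RecordPELELawsCofinal`, `stub_INJ0`, `spread_of_parts`)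
is UNCHANGED (0 FQN moves, 0 downstream bytes).  Statement bytes of every kept declaration, docstrings included, are the workfile՚s; the only other edits are (a) this re-headed module
docstring and (b) import l.1 `Lines.F0_P6a_PELInputs` switched to the P-LINE՚s ★ home `Summits.HodgeConjecture.HodgeConjecture.Theorems.F0P6aPELInputs` (K6 row; it must land first — until then this cand is GREEN-certified
at home by the PROBE variant whose l.1 is the tree P-LINE, identical otherwise), and (c) on the docstrings of the three header-CLOSED `def … : Prop` letters `RecordESpreadCofinal`∕`RecordInj0OfStageCofinal`∕`RecordPELELawsCofinal` the locator tokens are spelled `(print: …)` instead of `[cite: …]` (same locators; a `[cite:]`-tagged closed Prop in a `Theorems/` proposal is RELOCATED to `Literature/` by the gate — LA-ref1 (g5) BOX K5 #R1, p852785∕6; precedent ★ `F0P6aModuliDatumDefs` `(print:)`).  It is code-`sorry`-free and asserts nothing beyond what the workfile already proves: the PAID stub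
`stub_INJ0 : DualPairOfAmpleRigidified → RecordInj0OfStageCofinal` (BY TERM over ★ `PolarizedTupleStageSpecialInjectivity`, p848591) and the PARAMETRIC head
`spread_of_parts (hG) (hI) (hL) : DualPairOfAmpleRigidified → RecordPELSpreadCofinal` (§3) are [propext, Classical.choice, Quot.sound].

Why: a `Theorems/` file cannot import a `Lines/` workfile (F0P6-ref1 o-6), this hub still holds two OFF-PATH literal `sorry`s (closed BY NAME downstream by the leaves), and its
3 direct `Lines` importers (`F0_P6a_StubGSPREAD`, `F0_P6a_StubGEN`, `F0_P6a_ModuliDatum`) can only be re-homed under `Theorems/` once a sorry-free ★ home of the hub՚s DEFINITIONS exists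
(RE-HOME TABLE v1.7 §C).  After this file is ★ the hub becomes ED. 2 = `import Summits.HodgeConjecture.HodgeConjecture.Theorems.F0P6aPELSpreadDefs` + `HarnessLib` (+ carrier
`HarnessLib.Audit.LibrarySuggestionsDenyListCruxes`) + its preamble + the three cut blocks VERBATIM (a `Lines/` write on the LEAD՚s word, in the SAME request that turns the two `Lines`
originals `F0_P6a_StubKOTT`∕`F0_P6a_PELInputs` into shims of their ★ homes — so no environment ever holds two copies of a declaration).
HC_CM is proved only modulo the 7 printed citations (2 remaining: hLiu418 = stmt-HodgeConjecture-24832, h413 = stmt-HodgeConjecture-24833) until rung 0 closes; a re-home is count-neutral.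

## Original module docstring (verbatim)
# `F0_P6a_PELSpread` — THE L4 CLOSER LEAF ABOVE THE P-LINE: `spread_of_line : DualPairOfAmpleRigidified → RecordPELSpreadCofinal` (ED. 1 cand v4c, desk F0P6a-plan (g4); LEAD «M-55b» (2)+(4): STAGE CUT for `stub_INJ0` + `UnmixedAt` guards; v4c: `stub_INJ0` PAID IN-LINE by ★ p848591 — live sockets {`stub_GSPREAD`, `stub_ELAWS`})

CRUX `stmt-HodgeConjecture-24832` (HLiu418), sub-line P6a, line «L4».  SOCKET: the P-line `Lines/F0_P6a_PELInputs.lean` ED. 1 `stub_SPREAD`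
(`DualPairOfAmpleRigidified → RecordPELSpreadCofinal`, :664 of v6g 5e0f5e9c).  LEAD «M-55» (c) (2026-09-02T01:55:04Z): a closer LEAF ABOVE the P-line (imports the
served P-line olean), sockets BY NAME, head `spread_of_line` kernel-checked, SAME-STATEMENT tie against `stub_SPREAD`, consumed ONE LEVEL UP at MAIN ED. 8
`stub_RGD := rgd_of_inputs (pel_of_inputs spread_of_line stub_DUALS) datum_of_line`; ROAD (S♭) of record for the existence core («M-55» (b)).
Design memo: `F0/P6/F0P6a-plan/MEMO-PLINE-ED2-stubSPREAD.v1.F0P6a-plan-g4.md` (99417f65) §1–§2; this edition՚s memo v2 = the docstrings below.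

THE CUT (ED. 1 of the leaf, cand v4; JUNK-FREE, THREE sockets, each TRUE as typed; NO stage vocabulary in any statement — every `T` BY VALUE with
its PROVENANCE `T.τE = τE ∧ T.Φ = Φ ∧ HEq T.E E`):
* `stub_GSPREAD : DualPairOfAmpleRigidified → RecordESpreadCofinal` — **THE EXISTENCE CORE, ROAD (S♭)**: EVERY PEL witness `E` over the generic fibre
  `X = (S.M Kc) ⊗_F Fᵢ` of GEN՚s model `𝓜` (by value: ANY `E : PELWitnessE …`, junk included — spreading out is pure [EGA IV₃ 8.10.5] + dual existence)
  SPREADS, off a finite set `S_t(E)` of places, at every split `w ∉ S_t` with `Φ` adapted to `w`, to a localised tuple-with-provenance `T : PELSpreadAt … w …`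
  WHOSE WITNESS IS `E` — and (STAGE CUT, LEAD «M-55b» (2)) it EXPORTS WHAT THE CONSTRUCTOR KNOWS: one stage tuple `(t, 𝒜ₜ, ρₜ, Dₜ, polₜ, lvlₜ)` over
  `𝓜.total ⊗ D(t)` in front of `∃ S_t`, a localisation leg `τ : Spec 𝒪_{F,(w)} → D(t)` per good `w`, and the DEFINITIONAL provenance
  `IsStageLocalisationAt … T.univ T.act T.dual T.pol T.lvl` («`T` IS the stage tuple base-changed along `𝓜.total ◁ τ`», §0).  Payers: B-p18 (g39) ★ (s1♭) p847663 ∕ (s1-A♭) p847675 ∕ (hP-𝓜) (twins of `Limits/LocalizationRelativeProperSpread` +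
  `AbelianSchemes/AbelianSchemeOverSpreadStage` on the PROPER GENERIC FIBRE) and his 8-step chain census `F0/P6/B-p18/g39/CENSUS-stubGSPREAD-chain.v1` c894dffb;
  ★ (GS-2-core) p847586 `PELTupleStageLocalise` + ★ `TupleRelCancel`; ★ BRICK (T); ★ `exists_stage_ringAction` + ★ p847530∕p847650; `dualPairOf stub_DUALS`;
  ★ `exists_stage_polarization_of_generic_polarization_of_isUnit_two''`; ★ `LevelStructureSpreadRelative.exists_stage_of_generic_overStage`; (P-1) ★
  `Polarization.exists_quasiInverse` + «L4» LA4-p01 (Q-SPREAD) + (8) ROSATI∕POLQUASIINV at a stage; the arithmetic rows of `w`.  NO new letter, no Siegel scheme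
  over `ℤ[1∕N]` (road Σ parks, «M-55» (b)).
* `stub_INJ0 : DualPairOfAmpleRigidified → RecordInj0OfStageCofinal` — **(L1′) SPECIAL FINE-MODULI INJECTIVITY OFF A FINITE SET, FOR THE LOCALISATIONS OF ANY
  STAGE TUPLE, GIVEN A SEPARATING WITNESS** (A-p14 (g35) STAGE CUT, memo 9473015d §1; LEAD «M-55b» (2); `E`-free letter): for EVERY stage tuple by value there
  is a finite `S_inj` off which every `T` that IS its localisation (`IsStageLocalisationAt`, exported by `stub_GSPREAD`) and whose witness separates sheet points
  at `w` (`ESepAt S Kc w T.E`, exported by `stub_ELAWS`) satisfies `PELInj0LawAt T`.  TRUE: ★ (GS-3) p847613 per sheet over `Spec 𝓞_{Fᵢ}` + (GS-3a)(GS-3c)(GS-3d)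
  + pieces (b0)–(b4); NO rigidity-transfer organ (R1)–(R4), no `Isom` representability, no normality input.  Payers: A-p14 (GS-3)(GS-3c)(GS-3d), «L4» LA4-p02
  (GS-3a) ★ p847704 ∕ (b1), LA4-p03 (b2′) ★ p847793.
* `stub_ELAWS : RecordPELELawsCofinal` — **GEN՚s CHOICES + THE ADAPTED E-WITNESS FAMILY + ITS E-SIDE LAWS READ ON ANY SPREAD**: GEN՚s block `Fᵢ Kc G φ 𝓜`
  (O1–O4 ★ organs) once; a FINITE family of CM types `Φf i ∋ ι₁` with ONE slice embedding `τE` over `ι₁` and E-witnesses `Ef i : PELWitnessE … (Φf i)`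
  (the E-line head `pelWitnessE_of_line` per `Φ`, compositum of the slice fields, common small level); a finite `S_L`; and at every good split `w ∉ S_L`: the hyperspecial passage `K → Kc`, an index `i` with `Φf i` ADAPTED to `w` (KOTT leaf
  `exists_adapted_frame`), `hdisj` (★ INT-RES), and — for EVERY spread `T` of `Ef i` at `w` — `ESepAt S Kc w T.E` (a cast), `PELHeckeLawAt T` (E-export
  «Hecke-compatibility of `ε`» + transport along `T.gen_iso`) and `PELTwistLawAt T` (E-export «sheet law of `ε`» (Σ-GAL, A-p04) + Shimura–Taniyama at `w`
  for (FROB-𝔞)∕(FROB-n) («L4» LA4-p03 FROB-row arithmetic at the adapted frame) + transport).  TRUE because it speaks of THE witnesses it chooses — a law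
  `∀ T` WITHOUT an E-side hypothesis is FALSE (n5: constant CM families are `PELWitnessE`s), and the E-side hypotheses `EHeckeAt`∕`ETwistAt` (readings of
  `E`՚s tuple at `X`-points, i.e. `RoofΩ`∕`CoverΩ` with base `X` instead of `(𝓜.localise w).total`) are NOT YET TYPED by anyone: the day they are (leaf
  ED. 2), `stub_ELAWS` splits into `stub_GEN` (choices, ★) + `stub_EEXPORT` (E-line: `∃` family with `ESepAt ∧ EHeckeAt ∧ ETwistAt`) + the by-value
  transport stubs `stub_HECKE : ∀ T, EHeckeAt … T.E → PELHeckeLawAt T`, `stub_TWIST : ∀ T, ETwistAt … T.E → PELTwistLawAt T` of LEAD «M-55» (c).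
HEAD `spread_of_parts hG hI hL : DualPairOfAmpleRigidified → RecordPELSpreadCofinal` — SORRY-FREE ZIP (`S_M := S_L ∪ ⋃ i, (S_t i ∪ S_inj i)`, finite
union over the finite index; GEN՚s block PEELED by `Exists.elim`, B-p18 (g38) profile; per `w`: the spread of `hG`, `inj₀` of `hI`, the E-laws of `hL` at
that `T`), and `spread_of_line := spread_of_parts stub_GSPREAD stub_INJ0 stub_ELAWS`; SAME-STATEMENT tie `example : @stub_SPREAD = @spread_of_line := rfl` (elaborates iff the types agree).
Budgets: DEFAULT `maxHeartbeats` everywhere.  No instance, no notation.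
HC_CM is proved only modulo the printed citations (2 remaining named inputs hLiu418 24832, h413 24833) until rung 0 closes — count-neutral.
[cite: RapoportSmithlingZhang2020Diagonal, §4.1 Thm. 4.1 p. 17; Prop. 3.7 pp. 13–14] [cite: Kottwitz1992, §5 pp. 389–391]
[cite: EGAIV3, Thm. 8.10.5 (p. 37); Thm. 8.8.2 (p. 28)] [cite: MumfordFogartyKirwan1994, Ch. 7 §2 Def. 7.2 p. 129; §3 Thm. 7.9 p. 139]
[cite: Shimura1998, §18.6 Thm. 18.6 pp. 124–125] [cite: HarrisTaylorAMS2001, §III.4, pp. 108–110]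
-/

set_option autoImplicit false

noncomputable section

-- Mathlib's `Over`∕pull-back API is stated across semireducible wrappers (as in the ★ `AbelianSchemes/*` stage files).
set_option backward.isDefEq.respectTransparency false

namespace Summit.HodgeConjecture.HodgeConjecture.Cruxes.HLiu418.F0P6aPELSpread

set_option linter.dupNamespace false  -- `Summit.HodgeConjecture.HodgeConjecture.…` BY DESIGN (D-0017)

open CategoryTheory CategoryTheory.Limits NumberField IsDedekindDomain MulAction
open scoped Matrix Polynomial Pointwise
open Literature.NumberTheory.GaloisRepresentations
open Literature.NumberTheory.Automorphic Literature.NumberTheory.Automorphic.UnitaryGroup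
open Literature.AlgebraicGeometry.ShimuraVarieties.UnitaryCanonicalModel
open Literature.NumberTheory.Automorphic.Liu2021.AppendixC
open Literature.AlgebraicGeometry.Motives (AlgPoints IntegralModel SchemeOver thickening thickeningGalAction thickeningLift)
open Literature.NumberTheory.DiophantineGeometry (geomResidueField specialFibreFunctor)
open Literature.AlgebraicGeometry.RelativeSpec (ActionOver)
open Literature.NumberTheory.EllipticCurves (genericFibre)
open AlgebraicGeometry (QuasiCompact QuasiSeparated LocallyOfFinitePresentation Flat IsSeparated)
open Summit.HodgeConjecture.HodgeConjecture.Cruxes.HLiu418.F0P6aModuliDatumDefs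
open Summit.HodgeConjecture.HodgeConjecture.Cruxes.HLiu418.F0P6aRGDAssembly
open Summit.HodgeConjecture.HodgeConjecture.Cruxes.HLiu418.F0P6aPELWitnessE (PELWitnessE IsCMTypeThrough)
open Summit.HodgeConjecture.HodgeConjecture.Cruxes.HLiu418.F0P6aStubKOTT (KottAdaptedAt UnmixedAt)
open Summit.HodgeConjecture.HodgeConjecture.Cruxes.HLiu418.F0P6aPELInputs
open Literature.AlgebraicGeometry.Motives (specOver)
open Literature.AlgebraicGeometry.Limits.LocApprox (Idx baseDiagram)
open MonoidalCategory

/-! ### §0 The stage currency (B-p18 (g38∕g39) ★ GS-2-core `PELTupleStageLocalise` tokens): the localisation leg and «`T` IS the stage tuple localised at `w`» -/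

/-- **`stageLocLeg 𝓜 w t τ = 𝓜.total ◁ τ : 𝓨 = (𝓜.localise w).total = 𝓜.total ⊗ Spec 𝒪_{F,(w)} ⟶ 𝓜.total ⊗ D(t)`** — the LOCALISATION LEG of the
stage `D(t) = Spec 𝓞_F[1∕t]` at a place `w` reaching it (`τ : Spec 𝒪_{F,(w)} → D(t)` over `Spec 𝓞 F`, i.e. `t ∈ 𝒪_{F,(w)}ˣ` — «`w ∤ t`» BY VALUE, ★
`nonempty_hom_specOver_baseDiagram_of_isUnit` ∕ `eventually_nonempty_hom_specOver_valuationSubringAtPrime_baseDiagram`).  The ascribed source type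
`(𝓜.localise w).total.left` is ★ `localise_total` (`rfl`). [cite: EGAIV3, Thm. 8.8.2 (p. 28) and (8.8.2.5)] -/
def stageLocLeg {F : Type} [Field F] [NumberField F] {X : SchemeOver F} (𝓜 : IntegralModel (𝓞 F) F X) (w : HeightOneSpectrum (𝓞 F))
    (t : Idx (nonZeroDivisors (𝓞 F)))
    (τ : specOver (𝓞 F) (HeightOneSpectrum.valuationSubringAtPrime F w) ⟶ (baseDiagram (nonZeroDivisors (𝓞 F))).obj t) :
    (𝓜.localise w).total.left ⟶ (𝓜.total ⊗ (baseDiagram (nonZeroDivisors (𝓞 F))).obj t).left :=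
  (𝓜.total ◁ τ).left

/-- **`IsStageLocalisationAt 𝓜 w t τ 𝒜ₜ ρₜ Dₜ polₜ lvlₜ univ act dual pol lvl` — «THE TUPLE `(univ, act, dual, pol, lvl)` OVER `𝓨` IS THE STAGE TUPLE
`(𝒜ₜ, ρₜ, Dₜ, polₜ, lvlₜ)` BASE-CHANGED ALONG `stageLocLeg 𝓜 w t τ`»** — DEFINITIONAL PROVENANCE (an `Eq` on the abelian scheme, `HEq` on the dependent rows,
the level numerology `g' = g ∧ N' = N` explicit so that the consumer can `subst`): the A-p14 (g35) «STAGE CUT» (memo `MEMO-INJ0-CUT-stagefamily.v1` 9473015d §1,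
LEAD «M-55b» (2)) in the form the chain (1)–(8) of B-p18 (g39) produces it (★ GS-2-core head: «the `T`-tuple IS the base change along `P ◁ τ`») and the
strongest for the consumer (`stub_INJ0`: after `obtain ⟨…⟩ := T` and `subst`, the special fibres of `T` ARE fibres of the stage tuple — ★ `TupleRelFacObjIso`,
★ p847561).  A pointwise `TupleIsoAt₂` special reading is implied (★ BRICK (T)); it is not the letter because the two level structures carry different
numerology binders (`T.E.g` vs `E.g`).  A Prop; nothing asserted. [cite: MumfordFogartyKirwan1994, Ch. 7 §2 Definition 7.2 (p. 129)]
[cite: EGAIV3, Thm. 8.8.2 (p. 28) and (8.8.2.5)] -/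
def IsStageLocalisationAt {F : Type} [Field F] [NumberField F] {X : SchemeOver F} (𝓜 : IntegralModel (𝓞 F) F X) (w : HeightOneSpectrum (𝓞 F))
    (t : Idx (nonZeroDivisors (𝓞 F)))
    (τ : specOver (𝓞 F) (HeightOneSpectrum.valuationSubringAtPrime F w) ⟶ (baseDiagram (nonZeroDivisors (𝓞 F))).obj t)
    (𝒜ₜ : Literature.AlgebraicGeometry.AbelianSchemes.AbelianSchemeOver (𝓜.total ⊗ (baseDiagram (nonZeroDivisors (𝓞 F))).obj t).left)
    {O : Type} [CommRing O] (ρₜ : Literature.AlgebraicGeometry.AbelianSchemes.AbelianSchemeOver.RingAction O 𝒜ₜ) (Dₜ : 𝒜ₜ.DualPair)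
    (polₜ : 𝒜ₜ.Polarization Dₜ) {g N : ℕ} (lvlₜ : 𝒜ₜ.LevelStructure g N)
    (univ : Literature.AlgebraicGeometry.AbelianSchemes.AbelianSchemeOver (𝓜.localise w).total.left)
    (act : Literature.AlgebraicGeometry.AbelianSchemes.AbelianSchemeOver.RingAction O univ) (dual : univ.DualPair) (pol : univ.Polarization dual)
    {g' N' : ℕ} (lvl : univ.LevelStructure g' N') : Prop :=
  univ = 𝒜ₜ.baseChange (stageLocLeg 𝓜 w t τ) ∧ HEq act (ρₜ.baseChange (stageLocLeg 𝓜 w t τ)) ∧ HEq dual (Dₜ.baseChange (stageLocLeg 𝓜 w t τ)) ∧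
    HEq pol (polₜ.baseChange (stageLocLeg 𝓜 w t τ)) ∧ g' = g ∧ N' = N ∧ HEq lvl (lvlₜ.baseChange (stageLocLeg 𝓜 w t τ))

/-! ### §1 The three letters BY VALUE -/

/-- **LETTER `RecordESpreadCofinal`** (the conclusion of `stub_GSPREAD`; ROAD (S♭), LEAD «M-55» (b)) — **EVERY PEL WITNESS OVER THE GENERIC FIBRE SPREADS TO
COFINITELY MANY SPLIT PLACES**: for every letter context, every slice field `Fᵢ`, small level `Kc`, group `G`, model `𝓜` of the thickened record curve
(qc, qs, lfp, flat, separated structure map), every `τE` over `ι₁`, CM type `Φ ∋ ι₁` and EVERY `E : PELWitnessE … Kc Fᵢ τE Φ` (by value), there is a finite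
`S_t` such that at every split `w ∉ S_t`, for every smooth-proper structure `h𝓨`, action `θ` and sheet `e`, if `Φ` is adapted to `w` then SOME
`T : PELSpreadAt … w hw h𝓨 θ e` has witness `E` (`T.τE = τE`, `T.Φ = Φ`, `HEq T.E E`) — MORE PRECISELY (A-p14 STAGE CUT, LEAD «M-55b» (2); M-51 «export what
the constructor knows»): there is ONE STAGE TUPLE `(t, 𝒜ₜ, ρₜ, Dₜ, polₜ, lvlₜ)` over `𝓜.total ⊗ D(t)` (B-p18 (g39) chain (1)–(7): one common stage, census
`CENSUS-GS1-OneCommonStage`) such that off `S_t` every `w` reaches the stage by some `τ` (★ `eventually_nonempty_hom_specOver_valuationSubringAtPrime_baseDiagram`)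
and, if `Φ` is adapted AND UNMIXED at `w` («M-57b»: the payer fills `T.hΦw`∕`T.hΦu`), the `T` produced IS that stage tuple localised along `τ`
(`IsStageLocalisationAt`, chain step (8) = ★ GS-2-core).  Spreading out ([EGA IV₃] 8.10.5 on the PROPER generic fibre —
★ `exists_stage_isProper` consumes properness of the generic fibre only; the abelian scheme, its dual (P-2′), polarisation, level structure and `𝒪_F`-action
over a stage `𝓜.total ⊗ 𝓞_F[1∕t]`, then base change to `(𝓜.localise w).total` for `w ∤ t` with the generic reading carried: (GS-2-core) + BRICK (T)), the
rows `relDim comm rosati polQuasiInv` by stage cancellation, the arithmetic rows of `w` unconditionally, `gen_iso` by ★ GS-2-core (a) + ★ `tupleRel_comp_id_id`.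
TRUE for junk `E` too.  NOT asserted.
(print: EGAIV3, Thm. 8.10.5 (p. 37); Thm. 8.8.2 (p. 28)) (print: RapoportSmithlingZhang2020Diagonal, §4.1 Thm. 4.1 p. 17) (print: MumfordAV1970, §7 Thm. 4 (p. 72)) -/
def RecordESpreadCofinal : Prop :=
  ∀ (F : Type) [Field F] [NumberField F] [IsCMField F] [IsGalois ℚ F] (ι₁ : F →+* ℂ)
    (Jstar : Matrix (Fin 2) (Fin 2) F)
    (K₀ : C5.OpenCompactSubgroup ↥(finAdelic ↥(maximalRealSubfield F) F (IsCMField.complexConj F) 2 Jstar))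
    (S : RecordSystemGS F Jstar ι₁ K₀) (hU7ₛ : S.HeckeTranslateDefinedOver)
    (hJ : (Jstar.map (IsCMField.complexConj F))ᵀ = Jstar) (hJu : IsUnit Jstar)
    (Fi : Type) [Field Fi] [NumberField Fi] [Algebra F Fi] (Kc : C5.SmallLevel K₀) (G : Type) [Group G]
    (𝓜 : IntegralModel (𝓞 F) F ((thickening F Fi).obj (S.M.obj Kc))),
    QuasiCompact 𝓜.total.hom → QuasiSeparated 𝓜.total.hom → LocallyOfFinitePresentation 𝓜.total.hom →
      Flat 𝓜.total.hom → IsSeparated 𝓜.total.hom →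
    ∀ (τE : Fi →+* ℂ) (_hτE : τE.comp (algebraMap F Fi) = ι₁) (Φ : Set (F →+* ℂ)) (_hΦ : IsCMTypeThrough ι₁ Φ)
      (E : PELWitnessE F ι₁ Jstar K₀ S Kc Fi τE Φ),
    ∃ (t : Idx (nonZeroDivisors (𝓞 F)))
      (𝒜ₜ : Literature.AlgebraicGeometry.AbelianSchemes.AbelianSchemeOver (𝓜.total ⊗ (baseDiagram (nonZeroDivisors (𝓞 F))).obj t).left)
      (ρₜ : Literature.AlgebraicGeometry.AbelianSchemes.AbelianSchemeOver.RingAction (𝓞 F) 𝒜ₜ) (Dₜ : 𝒜ₜ.DualPair) (polₜ : 𝒜ₜ.Polarization Dₜ)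
      (lvlₜ : 𝒜ₜ.LevelStructure E.g E.N),
    ∃ S_t : Set (HeightOneSpectrum (𝓞 F)), S_t.Finite ∧
      ∀ w : HeightOneSpectrum (𝓞 F), w ∉ S_t →
        ∃ τ : specOver (𝓞 F) (HeightOneSpectrum.valuationSubringAtPrime F w) ⟶ (baseDiagram (nonZeroDivisors (𝓞 F))).obj t,
        ∀ (hw : (IsCMField.complexConj F) • w ≠ w)
        (h𝓨 : (𝓜.localise w).IsSmoothProper 1) (θ : ActionOver (𝓜.localise w).total.hom ((Fi ≃ₐ[F] Fi) × G))
        (e : Fi →ₐ[F] AlgebraicClosure (w.adicCompletion F)),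
        KottAdaptedAt ι₁ w Φ → UnmixedAt ι₁ w Φ →
          ∃ T : PELSpreadAt F ι₁ Jstar K₀ S hU7ₛ hJ hJu Fi Kc G 𝓜 w hw h𝓨 θ e, T.τE = τE ∧ T.Φ = Φ ∧ HEq T.E E ∧
            IsStageLocalisationAt 𝓜 w t τ 𝒜ₜ ρₜ Dₜ polₜ lvlₜ T.univ T.act T.dual T.pol T.lvl

/-- **LETTER `RecordInj0OfStageCofinal`** (the conclusion of `stub_INJ0`; A-p14 (g35) STAGE CUT, LEAD «M-55b» (2)) — `E`-FREE: the context prefix of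
`RecordESpreadCofinal` VERBATIM through the structure-map hypotheses of `𝓜`, then FOR EVERY STAGE TUPLE BY VALUE `(t, 𝒜ₜ, ρₜ, Dₜ, polₜ, lvlₜ : LevelStructure g N)`
over `𝓜.total ⊗ D(t)` (junk stage tuples harmless: a hypothesis position): a finite `S_inj` such that at every split `w ∉ S_inj`, for every localisation leg
`τ : Spec 𝒪_{F,(w)} → D(t)`, all `hw h𝓨 θ e` and EVERY `T : PELSpreadAt … w hw h𝓨 θ e` that IS the stage tuple localised along `τ`
(`IsStageLocalisationAt …`) and whose witness separates the `Ω_w`-points of its sheets (`ESepAt S Kc w T.E`): `PELInj0LawAt … T`.  TRUE: by cases on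
«the stage tuple separates sheet points over one (⇔ every, (GS-3c)) algebraically closed field» — if so, the COFINITE PASSAGE ★ (GS-3) p847613
`exists_finset_forall_eq_of_tupleIsoAt` per sheet over `Spec 𝓞_{Fᵢ}[1∕t′]` ((GS-3a) ★ p847704) with `hpieces` from ★ (b0) p847705 on an (I-EMB) atlas
((b1) LA4-p02, (b2′) ★ p847793, (b4)), and (GS-3d) reads `PELInj0LawAt T` off it (`T`՚s special points `spPt … ≫ stageLocLeg` lie over ONE closed point
`v_e` of `𝓞_{Fᵢ}`, ★ `specialSheet_eq_iff` ∕ SP3-b; `stageLocLeg` injective on geometric points); if not, `T.gen_iso` + `IsStageLocalisationAt` (★ GS-2-core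
`genericIso'_inv_left_comp_fst` + `hom_comp_eq_leg`) contradict `ESepAt S Kc w T.E`, so `S_inj := ∅` serves.  NO rigidity transfer, no `Isom` scheme, no
normality (memo 9473015d §0 (R1)–(R4) NOT commissioned).  NOT asserted. (print: MumfordFogartyKirwan1994, Ch. 7 §2 Prop. 7.3 (p. 132); §3 Thm. 7.9 (pp. 139–140))
(print: EGAIV3, (9.2.1)–(9.2.3); Thm. 8.8.2 (p. 28)) (print: RapoportSmithlingZhang2020Diagonal, §4.1 Thm. 4.1 p. 17) -/
def RecordInj0OfStageCofinal : Prop :=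
  ∀ (F : Type) [Field F] [NumberField F] [IsCMField F] [IsGalois ℚ F] (ι₁ : F →+* ℂ)
    (Jstar : Matrix (Fin 2) (Fin 2) F)
    (K₀ : C5.OpenCompactSubgroup ↥(finAdelic ↥(maximalRealSubfield F) F (IsCMField.complexConj F) 2 Jstar))
    (S : RecordSystemGS F Jstar ι₁ K₀) (hU7ₛ : S.HeckeTranslateDefinedOver)
    (hJ : (Jstar.map (IsCMField.complexConj F))ᵀ = Jstar) (hJu : IsUnit Jstar)
    (Fi : Type) [Field Fi] [NumberField Fi] [Algebra F Fi] (Kc : C5.SmallLevel K₀) (G : Type) [Group G]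
    (𝓜 : IntegralModel (𝓞 F) F ((thickening F Fi).obj (S.M.obj Kc))),
    QuasiCompact 𝓜.total.hom → QuasiSeparated 𝓜.total.hom → LocallyOfFinitePresentation 𝓜.total.hom →
      Flat 𝓜.total.hom → IsSeparated 𝓜.total.hom →
    ∀ (t : Idx (nonZeroDivisors (𝓞 F)))
      (𝒜ₜ : Literature.AlgebraicGeometry.AbelianSchemes.AbelianSchemeOver (𝓜.total ⊗ (baseDiagram (nonZeroDivisors (𝓞 F))).obj t).left)
      (ρₜ : Literature.AlgebraicGeometry.AbelianSchemes.AbelianSchemeOver.RingAction (𝓞 F) 𝒜ₜ) (Dₜ : 𝒜ₜ.DualPair) (polₜ : 𝒜ₜ.Polarization Dₜ)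
      (g N : ℕ) (lvlₜ : 𝒜ₜ.LevelStructure g N),
    ∃ S_inj : Set (HeightOneSpectrum (𝓞 F)), S_inj.Finite ∧
      ∀ w : HeightOneSpectrum (𝓞 F), w ∉ S_inj →
        ∀ (τ : specOver (𝓞 F) (HeightOneSpectrum.valuationSubringAtPrime F w) ⟶ (baseDiagram (nonZeroDivisors (𝓞 F))).obj t)
        (hw : (IsCMField.complexConj F) • w ≠ w)
        (h𝓨 : (𝓜.localise w).IsSmoothProper 1) (θ : ActionOver (𝓜.localise w).total.hom ((Fi ≃ₐ[F] Fi) × G))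
        (e : Fi →ₐ[F] AlgebraicClosure (w.adicCompletion F)) (T : PELSpreadAt F ι₁ Jstar K₀ S hU7ₛ hJ hJu Fi Kc G 𝓜 w hw h𝓨 θ e),
        IsStageLocalisationAt 𝓜 w t τ 𝒜ₜ ρₜ Dₜ polₜ lvlₜ T.univ T.act T.dual T.pol T.lvl →
        ESepAt S Kc w T.E → PELInj0LawAt F ι₁ Jstar K₀ S hU7ₛ hJ hJu Fi Kc G 𝓜 w hw h𝓨 θ e T

/-- **LETTER `RecordPELELawsCofinal`** (the conclusion of `stub_ELAWS`) — `RecordPELSpreadCofinal` TOKEN FOR TOKEN except: (i) after GEN՚s block, the FRAME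
FAMILY binders `(ιdx) (Finite ιdx) (Φf : ιdx → Set (F →+* ℂ)) (∀ i, IsCMTypeThrough ι₁ (Φf i)) (τE) (τE ∘ algebraMap = ι₁) (Ef : ∀ i, PELWitnessE … (Φf i))`
and the finite set renamed `S_L`; (ii) after the hyperspecial passage,
`∃ i : ιdx, KottAdaptedAt ι₁ w (Φf i) ∧`; (iii) the tail `∃ T : PELSpreadAt …, laws` ↦ `∀ T : PELSpreadAt …, T.τE = τE → T.Φ = Φf i → HEq T.E (Ef i) →
ESepAt S Kc w T.E ∧ PELHeckeLawAt … T ∧ PELTwistLawAt … T` (`inj₀` is `stub_INJ0`՚s, by value).  Reading: GEN՚s choices, a finite family of adapted frames with their E-witnesses over one slice field, and the ARITHMETIC LAWS OF THOSE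
WITNESSES read on any of their spreads (E-exports + transport along `gen_iso`; `inj₀` by the cofinite passage per sheet over `Spec 𝓞_{Fᵢ}`).  TRUE of the
witnesses it chooses; never universal over a by-value `E` (n5).  NOT asserted.
(print: RapoportSmithlingZhang2020Diagonal, §4.1 Thm. 4.1 p. 17) (print: Kottwitz1992, §5 pp. 389–391) (print: Shimura1998, §18.6 Thm. 18.6 pp. 124–125; §13.1 Thm. 1 pp. 97–99)
(print: HarrisTaylorAMS2001, §III.4, pp. 108–110) (print: MumfordFogartyKirwan1994, Ch. 7 §3 Thm. 7.9 p. 139) -/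
def RecordPELELawsCofinal : Prop :=
  ∀ (F : Type) [Field F] [NumberField F] [IsCMField F] [IsGalois ℚ F] (ι₁ : F →+* ℂ)
    (Jstar : Matrix (Fin 2) (Fin 2) F)
    (K₀ : C5.OpenCompactSubgroup ↥(finAdelic ↥(maximalRealSubfield F) F (IsCMField.complexConj F) 2 Jstar))
    (S : RecordSystemGS F Jstar ι₁ K₀) (hU7ₛ : S.HeckeTranslateDefinedOver)
    (hJ : (Jstar.map (IsCMField.complexConj F))ᵀ = Jstar) (hJu : IsUnit Jstar) (K : C5.SmallLevel K₀),
    ∃ (Fi : Type) (_ : Field Fi) (_ : NumberField Fi) (_ : Algebra F Fi) (_ : FiniteDimensional F Fi) (_ : IsGalois F Fi)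
      (Kc : C5.SmallLevel K₀) (_hKcK : Kc ≤ K) (_hn : ∀ k ∈ K.1.1, C5.HeckeLE k Kc Kc)
      (G : Type) (_ : Group G) (_ : Finite G) (φ : ↥K.1.1 →* G) (_hφ : Function.Surjective φ)
      (_hφker : φ.ker = (Kc.1.1 : Subgroup ↥(finAdelic ↥(maximalRealSubfield F) F (IsCMField.complexConj F) 2 Jstar)).subgroupOf K.1.1)
      (𝓜 : IntegralModel (𝓞 F) F ((thickening F Fi).obj (S.M.obj Kc)))
      (_ : QuasiCompact 𝓜.total.hom) (_ : QuasiSeparated 𝓜.total.hom) (_ : LocallyOfFinitePresentation 𝓜.total.hom)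
      (_ : Flat 𝓜.total.hom) (_ : IsSeparated 𝓜.total.hom)
      (ιdx : Type) (_ : Finite ιdx) (Φf : ιdx → Set (F →+* ℂ)) (_hΦf : ∀ i, IsCMTypeThrough ι₁ (Φf i))
      (τE : Fi →+* ℂ) (_hτE : τE.comp (algebraMap F Fi) = ι₁) (Ef : ∀ i, PELWitnessE F ι₁ Jstar K₀ S Kc Fi τE (Φf i))
      (S_L : Set (HeightOneSpectrum (𝓞 F))), S_L.Finite ∧
      ∀ w : HeightOneSpectrum (𝓞 F), w ∉ S_L → ∀ hw : (IsCMField.complexConj F) • w ≠ w,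
        (UnitaryGroup.isUnit_placeForm Jstar hJu w).unit ∈ glInt 2 (w.adicCompletion F) →
          UnitaryGroup.IsHyperspecialAt ↥(maximalRealSubfield F) F (IsCMField.complexConj F) 2 Jstar K.1.1
            (w.under (𝓞 ↥(maximalRealSubfield F))) →
          UnitaryGroup.IsHyperspecialAt ↥(maximalRealSubfield F) F (IsCMField.complexConj F) 2 Jstar Kc.1.1
              (w.under (𝓞 ↥(maximalRealSubfield F))) ∧
          ∃ i : ιdx, KottAdaptedAt ι₁ w (Φf i) ∧ UnmixedAt ι₁ w (Φf i) ∧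
          ∀ (h𝓨 : (𝓜.localise w).IsSmoothProper 1)
            (θ : ActionOver (𝓜.localise w).total.hom ((Fi ≃ₐ[F] Fi) × G))
            (_hθ : ∀ γ : Fi ≃ₐ[F] Fi,
               (genericFibre (HeightOneSpectrum.valuationSubringAtPrime F w) F).map
                     (Over.isoMk (θ.aut (γ, 1)) (θ.aut_comp (γ, 1))).hom ≫ (𝓜.localise w).genericIso'.hom
                 = (𝓜.localise w).genericIso'.hom ≫
                     (Over.isoMk ((thickeningGalAction (L := Fi) (S.M.obj Kc)).aut γ)
                       ((thickeningGalAction (L := Fi) (S.M.obj Kc)).aut_comp γ)).hom)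
            (e : Fi →ₐ[F] AlgebraicClosure (w.adicCompletion F)),
            haveI : AlgebraicGeometry.IsProper (𝓜.localise w).total.hom := h𝓨.2
            (∀ (β : Fi ≃ₐ[F] Fi) (P Q : AlgPoints (S.M.obj Kc) (AlgebraicClosure (w.adicCompletion F))),
                (𝓜.localise w).geomReductionMap (thickeningLift e (S.M.obj Kc) P) =
                  AlgPoints.map ((specialFibreFunctor w).map (Over.isoMk (θ.aut (β, 1)) (θ.aut_comp (β, 1))).hom :
                      (𝓜.localise w).reductionAt ⟶ (𝓜.localise w).reductionAt)
                    ((𝓜.localise w).geomReductionMap (thickeningLift e (S.M.obj Kc) Q)) → β = 1) ∧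
              ∀ T : PELSpreadAt F ι₁ Jstar K₀ S hU7ₛ hJ hJu Fi Kc G 𝓜 w hw h𝓨 θ e,
                T.τE = τE → T.Φ = Φf i → HEq T.E (Ef i) →
                ESepAt S Kc w T.E ∧ PELHeckeLawAt F ι₁ Jstar K₀ S hU7ₛ hJ hJu Fi Kc G 𝓜 w hw h𝓨 θ e T ∧ PELTwistLawAt F ι₁ Jstar K₀ S hU7ₛ hJ hJu Fi Kc G 𝓜 w hw h𝓨 θ e T

/-! ### §2 The registered stubs (letters BY VALUE; `stub_GSPREAD`∕`stub_ELAWS` bodies `sorry`, `stub_INJ0` PAID IN-LINE since cand v4c) -/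

/-! **SOCKET `stub_GSPREAD : DualPairOfAmpleRigidified → RecordESpreadCofinal` — NOT IN THE ★ RE-HOME; KEPT IN THE `Lines/` HUB** (`Lines/F0_P6a_PELSpread.lean` ED. 2 =
`import` of this ★ module + the two sockets `stub_GSPREAD`∕`stub_ELAWS` + the junction `spread_of_line`, SAME namespace, so every FQN and the books՚ socket census are unchanged).
A `Theorems/` file carries no `sorry`; the socket is closed BY NAME downstream (leaf `Lines/F0_P6a_StubGSPREAD.lean` `gspread_of_line`, read by MAIN `F0_P6a_ModuliDatum`).
K5-H3 «hub twin minus sockets» (LEAD F0P6-plan «M-140» (2); LA7-plan (g7) RE-HOME TABLE v1.7). -/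

/-- **`stub_INJ0` — (L1′) SPECIAL FINE-MODULI INJECTIVITY OFF A FINITE SET FOR THE LOCALISATIONS OF ANY STAGE TUPLE WITH A SEPARATING WITNESS** — PAID IN-LINE
(«L4» LA4-p03 (g0) CORE ZIP ★ p848591 `PolarizedTupleStageSpecialInjectivity`; `RecordInj0OfStageCofinal`; size L; A-p14 (g35)՚s lane + «L4» LA4-p02 (g0); the statement is BYTE-IDENTICAL to the boxed socket): the COFINITE PASSAGE ★ (GS-3) p847613 per sheet over
`Spec 𝓞_{Fᵢ}` ([MumfordFogartyKirwan1994] Thm. 7.9; A-p14 census v2 `CENSUS-stubINJ0-globalfamily.v2` — NOT over `Spec 𝓞_F` all pairs, FALSE), (GS-3a) ★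
p847704, pieces ★ p847681 ∕ (b0) p847705 ∕ (b1) ∕ (b2′) ★ p847793 ∕ (b4), (GS-3c) field-independence of sheet separation (A-p14 report-first
`TupleIsoGenericInjectivityFromOneField`), (GS-3d) the zip to `PELInj0LawAt T` through `IsStageLocalisationAt`.  The P-2′ antecedent is kept for uniformity
(the payer may ignore it).  Why it might fail: only if B-p18՚s chain cannot deliver the DEFINITIONAL provenance `IsStageLocalisationAt` (an `Eq`∕`HEq` on
base-changed data) — then the letter is re-cut to the pointwise `TupleIsoAt₂` special reading with an explicit numerology clause (desk, same day).
[cite: MumfordFogartyKirwan1994, Ch. 7 §2 Prop. 7.3 (p. 132); §3 Thm. 7.9 (pp. 139–140)] [cite: EGAIV3, (9.2.1)–(9.2.3)] -/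
theorem stub_INJ0 : DualPairOfAmpleRigidified → RecordInj0OfStageCofinal := by
  -- PAID («L4» LA4-p03 (g0), LA4-plan DEAL v3): the CORE ZIP ★ `exists_finite_forall_geomReductionMap_eq_of_tupleIso_stage` (Literature, all organs ★)
  -- after destructuring `T` and substituting the DEFINITIONAL provenance `IsStageLocalisationAt` (`Eq` on `univ`, `HEq` on `act dual pol lvl`, numerology).
  intro _ F _ _ _ _ ι₁ Jstar K₀ S hU7ₛ hJ hJu Fi _ _ _ Kc G _ 𝓜 hqc hqs hlfp _ hsep t 𝒜ₜ ρₜ Dₜ polₜ g N lvlₜ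
  obtain ⟨S_inj, hfin, hcore⟩ :=
    Literature.AlgebraicGeometry.AbelianSchemes.AbelianSchemeOver.exists_finite_forall_geomReductionMap_eq_of_tupleIso_stage
      (S.M.obj Kc) 𝓜 t 𝒜ₜ ρₜ Dₜ polₜ lvlₜ
  refine ⟨S_inj, hfin, fun w hwS τ hw h𝓨 θ e T hSL hEsep y₁ y₂ hiso => ?_⟩
  obtain ⟨τE, hτE, Φ, hΦ, hΦw, _hΦu, E, univ, act, dual, pol, lvl, _r1, _r2, _r3, pChar, hpChar, fDeg, _r4, _r5, _r6, _r7, gen_iso⟩ := T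
  obtain ⟨h1, h2, h3, h4, hg, hN, h5⟩ := hSL
  dsimp only at h1 h2 h3 h4 hg hN h5 hEsep hiso gen_iso ⊢
  subst h1 hg hN
  cases h2
  cases h3
  cases h4
  cases h5
  haveI := h𝓨.2
  exact hcore w hwS τ e E.P.A E.ρ E.P.D E.P.pol E.P.level (hEsep e) (gen_iso e) y₁ y₂ hiso

/-! **SOCKET `stub_ELAWS : RecordPELELawsCofinal` — NOT IN THE ★ RE-HOME; KEPT IN THE `Lines/` HUB** (ED. 2, same namespace).  Closed BY NAME downstream (leaf
`Lines/F0_P6a_StubGEN.lean` `elaws_of_line`, read by MAIN).  K5-H3. -/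

/-! ### §3 The head -/

/-- **PARAMETRIC HEAD `spread_of_parts (hG) (hI) (hL) : DualPairOfAmpleRigidified → RecordPELSpreadCofinal`** — SORRY-FREE ZIP: GEN՚s block and the frame
family from `hL` (peeled by `Exists.elim`, B-p18 (g38) profile — never a 30-pattern `obtain` against the letter-sized goal); per frame index the spreading set
of `hG` and the injectivity set of `hI` by `choose`; `S_M := S_L ∪ ⋃ i, (S_t i ∪ S_inj i)` (finite: `Set.Finite.union`,
`Set.finite_iUnion` over `Finite ιdx`; the stage tuple of `hG` is what `hI` is instantiated at); at `w ∉ S_M`: the hyperspecial passage and the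
adapted-unmixed index `i` from `hL`, the leg `τ` and the spread `T` of `Ef i` with its stage provenance from `hG`, `inj₀` from `hI` at `(τ, T)` (fed with the
stage provenance and the separation clause of `hL`՚s guarantee), the E-laws from `hL`՚s guarantee at `T`. [cite: RapoportSmithlingZhang2020Diagonal, §4.1 Thm. 4.1 p. 17] -/
theorem spread_of_parts (hG : DualPairOfAmpleRigidified → RecordESpreadCofinal)
    (hI : DualPairOfAmpleRigidified → RecordInj0OfStageCofinal) (hL : RecordPELELawsCofinal) :
    DualPairOfAmpleRigidified → RecordPELSpreadCofinal := by
  intro hDUALS F _ _ _ _ ι₁ Jstar K₀ S hU7ₛ hJ hJu K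
  refine (hL F ι₁ Jstar K₀ S hU7ₛ hJ hJu K).elim fun Fi h => h.elim fun iF h => h.elim fun iNF h =>
    h.elim fun iA h => h.elim fun iFD h => h.elim fun iG h => h.elim fun Kc h => h.elim fun hKcK h => h.elim fun hn h =>
    h.elim fun G h => h.elim fun iGr h => h.elim fun iFin h => h.elim fun φ h => h.elim fun hφ h => h.elim fun hφker h =>
    h.elim fun 𝓜 h => h.elim fun i1 h => h.elim fun i2 h => h.elim fun i3 h => h.elim fun i4 h => h.elim fun i5 h =>
    h.elim fun ιdx h => h.elim fun iι h => h.elim fun Φf h => h.elim fun hΦf h => h.elim fun τE h => h.elim fun hτE h =>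
    h.elim fun Ef h => h.elim fun S_L h => ?_
  -- per frame index: the finite spreading set of `hG` and the finite injectivity set of `hI` for the witness `Ef i`
  have hGi := fun i : ιdx => hG hDUALS F ι₁ Jstar K₀ S hU7ₛ hJ hJu Fi Kc G 𝓜 i1 i2 i3 i4 i5 τE hτE (Φf i) (hΦf i) (Ef i)
  choose t 𝒜t ρt Dt polt lvlt S_t hS_t hT using hGi
  have hIi := fun i : ιdx => hI hDUALS F ι₁ Jstar K₀ S hU7ₛ hJ hJu Fi Kc G 𝓜 i1 i2 i3 i4 i5 (t i) (𝒜t i) (ρt i) (Dt i) (polt i) (Ef i).g (Ef i).N (lvlt i)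
  choose S_j hS_j hJ0 using hIi
  refine ⟨Fi, iF, iNF, iA, iFD, iG, Kc, hKcK, hn, G, iGr, iFin, φ, hφ, hφker, 𝓜, i1, i2, i3, i4, i5, S_L ∪ ⋃ i, (S_t i ∪ S_j i),
    h.1.union (Set.finite_iUnion fun i => (hS_t i).union (hS_j i)), ?_⟩
  intro w hwS hw hunit hK
  have hwL : w ∉ S_L := fun h' => hwS (Or.inl h')
  have hwT : ∀ i, w ∉ S_t i := fun i h' => hwS (Or.inr (Set.mem_iUnion.2 ⟨i, Or.inl h'⟩))
  have hwJ : ∀ i, w ∉ S_j i := fun i h' => hwS (Or.inr (Set.mem_iUnion.2 ⟨i, Or.inr h'⟩))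
  have hKw := h.2 w hwL hw hunit hK
  refine ⟨hKw.1, fun h𝓨 θ hθ e => ?_⟩
  refine hKw.2.elim fun i hi => ?_
  have hin := hi.2.2 h𝓨 θ hθ e
  refine (hT i w (hwT i)).elim fun τ hTτ => ?_
  refine (hTτ hw h𝓨 θ e hi.1 hi.2.1).elim fun T hTE => ?_
  have hlaw := hin.2 T hTE.1 hTE.2.1 hTE.2.2.1
  exact ⟨hin.1, T, hlaw.1, hJ0 i w (hwJ i) τ hw h𝓨 θ e T hTE.2.2.2 hlaw.1, hlaw.2.1, hlaw.2.2⟩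

/-! **JUNCTION `spread_of_line : DualPairOfAmpleRigidified → RecordPELSpreadCofinal := spread_of_parts stub_GSPREAD stub_INJ0 stub_ELAWS` — NOT IN THE ★ RE-HOME; KEPT IN THE
`Lines/` HUB** (ED. 2, same namespace), next to the two sockets it instantiates.  The sorry-free PARAMETRIC head `spread_of_parts` above (and the PAID `stub_INJ0`) is what MAIN reads
(`pel_of_inputs (spread_of_parts gspread_of_line stub_INJ0 elaws_of_line) …`).  K5-H3. -/

/-! SAME-STATEMENT TIE RETIRED (P-LINE ED. 4 «dead letters out», LEAD «M-95» (2)): the ED. 1 tie `example : @stub_SPREAD = @spread_of_line := rfl` named the P-line socket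
`stub_SPREAD`, which P-LINE ED. 4 retires (MAIN ED. 9 consumes `spread_of_parts` BY NAME; the head՚s type `DualPairOfAmpleRigidified → RecordPELSpreadCofinal` is explicit above). -/

end Summit.HodgeConjecture.HodgeConjecture.Cruxes.HLiu418.F0P6aPELSpread

end
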